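import Literature.Analysis.FluidPDE.BoundedAnnihilator
import Literature.Analysis.FluidPDE.HarmonicLiouvilleLp
import Literature.Analysis.FluidPDE.VorticityStretching
import HarnessLib

/-!
# Liouville's theorem for bounded irrotational incompressible fields on `EuclideanSpace ℝ (Fin 3)`

Analysis/FluidPDE support file on the decomposition path of the named fact
`Literature.Analysis.FluidPDE.KNSS2009_liouville_axisymmetric_no_swirl` (Koch–Nadirashvili–
Seregin–Šverák, Acta Math. 203 (2009) = arXiv:0709.3599, Theorem 5.2). The printed proofs of
Theorems 5.1 and 5.2 end with: "Hence `curl u = 0` … which, together with `div u = 0` and the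
boundedness of `u`, implies (by the classical Liouville theorem for harmonic functions) that `u`
is constant in `x` for each `t`" (arXiv p. 9) and "the proof is finished by again applying the
Liouville theorem to the system `curl u = 0`, `div u = 0`" (p. 10). This file proves that step
for classical (`C²`) fields:

* `laplacian_eq_zero_of_curl_eq_zero_of_isDivFree`: a `C²` field `V : EuclideanSpace ℝ (Fin 3) → EuclideanSpace ℝ (Fin 3)` with
  `curl V = 0` and `div V = 0` is (vector-)harmonic, `ΔV = 0` (in coordinates
  `ΔVᵢ = Σⱼ ∂ⱼ∂ⱼVᵢ = Σⱼ ∂ⱼ∂ᵢVⱼ = ∂ᵢ div V = 0`, using `∂ⱼVᵢ = ∂ᵢVⱼ` and the symmetry of second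
  derivatives);
* `eq_of_curl_eq_zero_of_isDivFree_of_bounded`: if moreover `V` is bounded then `V` is constant
  (each coordinate is a bounded harmonic function; Liouville,
  `InnerProductSpace.HarmonicOnNhd.apply_eq_apply_of_abs_le` of `BoundedAnnihilator`).

## References

* G. Koch, N. Nadirashvili, G. Seregin, V. Šverák, *Liouville theorems for the Navier–Stokes
  equations and applications*, Acta Math. 203 (2009) 83–105 = arXiv:0709.3599, end of the proofs
  of Theorems 5.1 (p. 9) and 5.2 (p. 10); Lemma 3.1 (p. 7). [KochNadirashviliSereginSverak2009]
* D. Gilbarg, N. S. Trudinger, *Elliptic partial differential equations of second order* (2001),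
  Theorem 2.1 and the Liouville theorem. [GilbargTrudinger2001]
-/

noncomputable section

open Set Function InnerProductSpace
open scoped Laplacian InnerProductSpace RealInnerProductSpace ContDiff

namespace Literature.Analysis.FluidPDE

/-! ### Irrotational Jacobians are symmetric -/

/-- `curl` vanishes exactly when the Jacobian matrix is symmetric in the standard coordinates:
if `curlCLM L = 0` then `(L eⱼ)ᵢ = (L eᵢ)ⱼ` for all `i, j`. [folklore] -/
theorem apply_single_comm_of_curlCLM_eq_zero {L : EuclideanSpace ℝ (Fin 3) →L[ℝ] EuclideanSpace ℝ (Fin 3)} (h : curlCLM L = 0) (i j : Fin 3) :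
    L (EuclideanSpace.single j (1 : ℝ)) i = L (EuclideanSpace.single i (1 : ℝ)) j := by
  rw [curlCLM_apply] at h
  have h0 := congrFun (congrArg (⇑) h) 0
  have h1 := congrFun (congrArg (⇑) h) 1
  have h2 := congrFun (congrArg (⇑) h) 2
  simp only [Matrix.cons_val_zero, Matrix.cons_val_one, Matrix.cons_val_two,
    Matrix.head_cons, Matrix.tail_cons, PiLp.zero_apply] at h0 h1 h2
  fin_cases i <;> fin_cases j <;> simp <;> linarith

/-! ### `curl V = 0`, `div V = 0` ⇒ `ΔV = 0` -/

/-- The derivative of a coordinate of a directional derivative is the corresponding coordinate of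
the second derivative: `∂ₖ (y ↦ (DV(y) h)ᵢ) (x) = (D²V(x) k h)ᵢ` for `V ∈ C²`. [folklore] -/
theorem fderiv_fderiv_apply_coord {V : EuclideanSpace ℝ (Fin 3) → EuclideanSpace ℝ (Fin 3)} (hV : ContDiff ℝ 2 V) (x h k : EuclideanSpace ℝ (Fin 3)) (i : Fin 3) :
    fderiv ℝ (fun y => fderiv ℝ V y h i) x k = fderiv ℝ (fderiv ℝ V) x k h i := by
  have hd : DifferentiableAt ℝ (fderiv ℝ V) x :=
    ((hV.fderiv_right (m := 1) le_rfl).differentiable one_ne_zero) x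
  have hdh : DifferentiableAt ℝ (fun y => fderiv ℝ V y h) x := hd.clm_apply (differentiableAt_const h)
  have e1 : (fun y => fderiv ℝ V y h i) = (EuclideanSpace.proj i : EuclideanSpace ℝ (Fin 3) →L[ℝ] ℝ) ∘ fun y => fderiv ℝ V y h := by
    funext y; rfl
  rw [e1, fderiv_comp x (EuclideanSpace.proj i : EuclideanSpace ℝ (Fin 3) →L[ℝ] ℝ).differentiableAt hdh,
    ContinuousLinearMap.fderiv, ContinuousLinearMap.comp_apply,
    fderiv_clm_apply hd (differentiableAt_const h)]
  simp

/-- **An irrotational incompressible `C²` field is harmonic**: `curl V = 0` and `div V = 0` on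
`EuclideanSpace ℝ (Fin 3)` imply `ΔV = 0` (coordinates: `ΔVᵢ = Σⱼ ∂ⱼ∂ⱼVᵢ = Σⱼ ∂ⱼ∂ᵢVⱼ = Σⱼ ∂ᵢ∂ⱼVⱼ = ∂ᵢ(div V) = 0`;
KNSS 2009 invoke this as "the Liouville theorem for the system `curl u = 0`, `div u = 0`",
arXiv:0709.3599 pp. 7, 9, 10). [folklore] -/
theorem laplacian_eq_zero_of_curl_eq_zero_of_isDivFree {V : EuclideanSpace ℝ (Fin 3) → EuclideanSpace ℝ (Fin 3)} (hV : ContDiff ℝ 2 V)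
    (hcurl : ∀ x, curl V x = 0) (hdiv : VectorCalculus.IsDivFree V) (x : EuclideanSpace ℝ (Fin 3)) : (Δ V) x = 0 := by
  set T : EuclideanSpace ℝ (Fin 3) →L[ℝ] EuclideanSpace ℝ (Fin 3) →L[ℝ] EuclideanSpace ℝ (Fin 3) := fderiv ℝ (fderiv ℝ V) x with hT
  -- (1) symmetry of the Jacobian at every point
  have hsym : ∀ (y : EuclideanSpace ℝ (Fin 3)) (i j : Fin 3), fderiv ℝ V y (EuclideanSpace.single j (1 : ℝ)) i = fderiv ℝ V y (EuclideanSpace.single i (1 : ℝ)) j := fun y i j =>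
    apply_single_comm_of_curlCLM_eq_zero (by rw [← curl_eq_curlCLM]; exact hcurl y) i j
  -- (2) hence symmetry of the second derivative in the value/direction indices
  have hT1 : ∀ i j k : Fin 3, T (EuclideanSpace.single k (1 : ℝ)) (EuclideanSpace.single j (1 : ℝ)) i = T (EuclideanSpace.single k (1 : ℝ)) (EuclideanSpace.single i (1 : ℝ)) j := by
    intro i j k
    rw [hT, ← fderiv_fderiv_apply_coord hV x (EuclideanSpace.single j (1 : ℝ)) (EuclideanSpace.single k (1 : ℝ)) i,
      ← fderiv_fderiv_apply_coord hV x (EuclideanSpace.single i (1 : ℝ)) (EuclideanSpace.single k (1 : ℝ)) j]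
    have e : (fun y => fderiv ℝ V y (EuclideanSpace.single j (1 : ℝ)) i) = fun y => fderiv ℝ V y (EuclideanSpace.single i (1 : ℝ)) j :=
      funext fun y => hsym y i j
    rw [e]
  -- (3) symmetry of the second derivative in its two directions
  have hT2 : ∀ h k : EuclideanSpace ℝ (Fin 3), T h k = T k h := fun h k =>
    (hV.contDiffAt.isSymmSndFDerivAt (by simp)) h k
  -- (4) the derivative of the divergence vanishes
  have hdiv' : ∀ k : EuclideanSpace ℝ (Fin 3), ∑ j, T k (EuclideanSpace.single j (1 : ℝ)) j = 0 := by
    intro k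
    have hzero : (fun y => ∑ j, fderiv ℝ V y (EuclideanSpace.single j (1 : ℝ)) j) = fun _ => (0 : ℝ) := by
      funext y
      have := hdiv y
      rw [VectorCalculus.divergence, trace_eq_sum_coord] at this
      exact this
    have h1 : fderiv ℝ (fun y => ∑ j, fderiv ℝ V y (EuclideanSpace.single j (1 : ℝ)) j) x k = ∑ j, T k (EuclideanSpace.single j (1 : ℝ)) j := by
      have hdj : ∀ j : Fin 3, DifferentiableAt ℝ (fun y => fderiv ℝ V y (EuclideanSpace.single j (1 : ℝ)) j) x := by
        intro j
        have hd : DifferentiableAt ℝ (fderiv ℝ V) x :=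
          ((hV.fderiv_right (m := 1) le_rfl).differentiable one_ne_zero) x
        have hdh : DifferentiableAt ℝ (fun y => fderiv ℝ V y (EuclideanSpace.single j (1 : ℝ))) x :=
          hd.clm_apply (differentiableAt_const _)
        have e1 : (fun y => fderiv ℝ V y (EuclideanSpace.single j (1 : ℝ)) j) =
            (EuclideanSpace.proj j : EuclideanSpace ℝ (Fin 3) →L[ℝ] ℝ) ∘ fun y => fderiv ℝ V y (EuclideanSpace.single j (1 : ℝ)) := by
          funext y; rfl
        rw [e1]
        exact (EuclideanSpace.proj j : EuclideanSpace ℝ (Fin 3) →L[ℝ] ℝ).differentiableAt.comp x hdh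
      rw [fderiv_fun_sum fun j _ => hdj j, _root_.sum_apply]
      exact Finset.sum_congr rfl fun j _ => fderiv_fderiv_apply_coord hV x _ _ j
    rw [← h1, hzero]
    simp
  -- (5) assemble, coordinate by coordinate
  have hΔ : (Δ V) x = ∑ j, T (EuclideanSpace.single j (1 : ℝ)) (EuclideanSpace.single j (1 : ℝ)) := by
    rw [laplacian_eq_sum_fderiv_fderiv (EuclideanSpace.basisFun (Fin 3) ℝ) hV x]
    refine Finset.sum_congr rfl fun j _ => ?_
    have hd : DifferentiableAt ℝ (fderiv ℝ V) x :=
      ((hV.fderiv_right (m := 1) le_rfl).differentiable one_ne_zero) x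
    simp only [EuclideanSpace.basisFun_apply]
    rw [fderiv_clm_apply hd (differentiableAt_const _)]
    simp [hT]
  ext i
  rw [hΔ]
  simp only [PiLp.zero_apply]
  rw [show (∑ j, T (EuclideanSpace.single j (1 : ℝ)) (EuclideanSpace.single j (1 : ℝ))) i = ∑ j, T (EuclideanSpace.single j (1 : ℝ)) (EuclideanSpace.single j (1 : ℝ)) i from by simp [Finset.sum_apply]]
  calc ∑ j, T (EuclideanSpace.single j (1 : ℝ)) (EuclideanSpace.single j (1 : ℝ)) i = ∑ j, T (EuclideanSpace.single j (1 : ℝ)) (EuclideanSpace.single i (1 : ℝ)) j := Finset.sum_congr rfl fun j _ => hT1 i j j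
    _ = ∑ j, T (EuclideanSpace.single i (1 : ℝ)) (EuclideanSpace.single j (1 : ℝ)) j := Finset.sum_congr rfl fun j _ => by rw [hT2]
    _ = 0 := hdiv' (EuclideanSpace.single i (1 : ℝ))

/-! ### Liouville: bounded irrotational incompressible fields are constant -/

/-- **Liouville's theorem for the system `curl V = 0`, `div V = 0`.** A bounded `C²` vector
field on `EuclideanSpace ℝ (Fin 3)` with vanishing curl and divergence is constant: every coordinate `Vᵢ` is a bounded
harmonic function (`laplacian_eq_zero_of_curl_eq_zero_of_isDivFree`), hence constant by
Liouville's theorem for harmonic functions (KNSS 2009, Lemma 3.1 and the last lines of the proofs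
of Theorems 5.1–5.2: "bounded solutions of the system `curl z = 0` and `div z = 0` in `ℝⁿ` are
constant by Liouville's theorem"). [cite: KochNadirashviliSereginSverak2009, Lemma 3.1 (arXiv p. 7) and proof of Thm 5.2, last sentence (p. 10)] -/
theorem eq_of_curl_eq_zero_of_isDivFree_of_bounded {V : EuclideanSpace ℝ (Fin 3) → EuclideanSpace ℝ (Fin 3)} (hV : ContDiff ℝ 2 V)
    (hcurl : ∀ x, curl V x = 0) (hdiv : VectorCalculus.IsDivFree V) {M : ℝ} (hM : ∀ x, ‖V x‖ ≤ M)
    (x y : EuclideanSpace ℝ (Fin 3)) : V x = V y := by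
  have hΔ := laplacian_eq_zero_of_curl_eq_zero_of_isDivFree hV hcurl hdiv
  ext i
  -- the coordinate `Vᵢ` is `C²`, harmonic and bounded
  set η : EuclideanSpace ℝ (Fin 3) → ℝ := fun z => V z i with hη
  have hηeq : η = (EuclideanSpace.proj i : EuclideanSpace ℝ (Fin 3) →L[ℝ] ℝ) ∘ V := by funext z; rfl
  have hη2 : ContDiff ℝ 2 η := by
    rw [hηeq]; exact (EuclideanSpace.proj i : EuclideanSpace ℝ (Fin 3) →L[ℝ] ℝ).contDiff.comp hV
  have hηΔ : ∀ z, (Δ η) z = 0 := fun z => by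
    rw [hηeq, hV.contDiffAt.laplacian_CLM_comp_left, Function.comp_apply, hΔ z, map_zero]
  have hharm : HarmonicOnNhd η univ := harmonicOnNhd_of_laplacian_eq_zero hη2 hηΔ
  have hbdd : ∀ z, |η z| ≤ M := fun z =>
    le_trans (by simpa [hη, Real.norm_eq_abs] using PiLp.norm_apply_le (V z) i) (hM z)
  exact hharm.apply_eq_apply_of_abs_le hbdd x y

end Literature.Analysis.FluidPDE

end
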